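import Mathlib
import Summits.Langlands.Langlands.Theses.PicardMuOrdinary
import Summits.Langlands.Langlands.Theorems.PicardMuOrdinaryIrregularClassicalityDefs
import Summits.Langlands.Langlands.Theorems.PicardMuOrdinaryIrregularClassicalityReduction
import Summits.Langlands.Langlands.Theorems.PicardMuOrdinaryIrregularClassicalityTwistedPicardGaloisInput
import Summits.Langlands.Langlands.Theorems.PicardMuOrdinaryIrregularClassicalityIrregularDescentUntwist
import Summits.Langlands.Langlands.Theorems.PicardMuOrdinaryIrregularClassicalityLimitTwist
import Literature.NumberTheory.GaloisRepresentations.PicardCurveGaloisRep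
import Literature.NumberTheory.Automorphic.ReciprocityGLnProofs
import Literature.NumberTheory.Automorphic.AsaiSign
import HarnessLib

/-!
# Route `PicardMuOrdinary`, crux `IrregularClassicality` (stmt-Langlands-13758): the SLOPE-FREE reduction of the
# line `slope-free-polarized-limit`, kernel-checked in the built tree

Continuation lead prover-line-stmt-Langlands-13758-c10-0, 2026-08-17.  Companion of
`PicardMuOrdinaryIrregularClassicalityReduction.lean` (the ORDINARY kit of leads c1–c4) for the strategist's
reduction-ready line `slope-free-polarized-limit` (registered skeleton `Cruxes/IrregularClassicality/Lines/
slope_free_polarized_limit.lean`, stubs P `stub_picardFact` / W `stub_polarizationDebt` / H `stub_senClassicalityLinked`,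
Stub L `stub_limitTwist` LANDED in `PicardMuOrdinaryIrregularClassicalityLimitTwist.lean`).  Up to now the slope-free
composition and its restate certificates lived only in crux WORKFILES (`Lines/slope_free_polarized_limit.lean`,
`IrregularClassicalitySplit.lean`), which the build never sees and nothing can import.  This file states them as
CONDITIONAL THEOREMS with the open statements written out VERBATIM (byte-identical with the registered stubs and with
the prepared split's `children.json`: W = child `PolarizationDebt`, C3 = child `IrregularClassicalityPolarized`), and no
new definition:

1. `irregularClassicalityPolarized_of_heart` — the restated crux **C3** (`IrregularClassicalityPolarized`: an exactly
   `c₀`-polarized twisted `3`-adic tower with Galois avatars ⇒ `C_f` automorphic) from the Picard named fact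
   `picardCurve_exists_lambdaAdicRep` and the slope-free Galois-side heart **H** ONLY (landed Stub 2
   `stub_twistedPicardGaloisInput`, `primaryGen_unique`, landed Stub 6 `stub_irregularDescentUntwist` do the rest).
2. `irregularClassicality_of_polarized` — **the typed crux BY NAME from W and C3**: the glue
   `LimitTwist → PolarizationDebt → IrregularClassicalityPolarized → IrregularClassicality` of the prepared split with its
   first child already discharged by the landed `stub_limitTwist`.
3. `irregularClassicality_of_wall_of_heart` — the typed crux by name from the Picard fact, **W** and **H** (= the
   registered skeleton's `IrregularClassicality_of` with its three `sorry`s as hypotheses).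
4. `picardAutomorphy_of_polarized` / `closes_polarized` — **the slope-free re-routed deciding theorem**:
   `ResidualAutomorphyOdd → ResidualAutomorphyEven → MuOrdinaryFamilyRTPolarized → IrregularClassicalityPolarized →
   SectorComplement → Langlands`, where `MuOrdinaryFamilyRTPolarized` is 13757 with its conclusion restated as C3's
   hypothesis — the SAME SHAPE as the route's `closes` (four items + complement), with NO third branch (the ordinary
   kit's `closes_ord` needs `BasicLocusAutomorphy` in addition); read-backs: C3 is a weakening of the target
   (`irregularClassicalityPolarized_of_picardAutomorphy`, no refutation room) and implies the ordinary restate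
   (`irregularClassicalityOrd_of_polarized`).

Nothing here closes the item: (1)–(3) are conditional on open statements (W = the `3`-adic descent wall, unprovable as
typed and moot under the restate; H = irregular-weight classicality for `U(2,1)` at the ramified prime `3`, not in
print).  What the file certifies for the tenure planner: the slope-free restate of the 13757 → 13758 interface
(13757' = `MuOrdinaryFamilyRTPolarized`, 13758' = C3) re-closes the route verbatim, concedes no λ-basic remainder, and
leaves exactly one open theorem behind 13758' (H, modulo the Picard fact).
-/

-- `Summit.Langlands.Langlands.…` (summit = sub-problem name, D-0017 layout) trips `dupNamespace` on every decl.
set_option linter.dupNamespace false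
set_option autoImplicit false

namespace Summit.Langlands.Langlands.Theorems.IrregularClassicality.SlopeFreePolarizedLimit

open scoped NumberField Polynomial Classical
open IsDedekindDomain NumberField Polynomial
open Literature.NumberTheory.GaloisRepresentations Literature.NumberTheory.Automorphic
open Summit.Langlands.Langlands.Theses.PicardMuOrdinary
open Summit.Langlands.Langlands.Theorems.IrregularClassicality.SplitRamifiedPrimeSqrt6

noncomputable section

/-! ## 1. The restated crux C3 from the Picard fact and the heart H -/

/-- **Stubs P + H close C3.**  Given the Picard named fact and the slope-free heart H (registered stub
`stub_senClassicalityLinked` VERBATIM: for generic `f`, `ι`, `e`, a twisted Picard witness `(S₀ ∋ λ, ϖ, ρ)` absolutely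
irreducible on every quadratic `Γ_L`, a complex conjugation `c₀ ≠ 1`, a level `S_K ⊇ S₀` and an exactly `c₀`-polarized
regular cuspidal tower with avatars for the twisted traces off `S_K`, the representation `ρ` is automorphic over `K`),
the restated crux C3 (`IrregularClassicalityPolarized` of the prepared split, VERBATIM) holds.  Proof: unpack
`(e, ι, S, c₀, ϖ, towers)`; Stub 2 (landed, on the Picard fact) gives `S₀ ⊇ {v ∣ 3}`, primary `ϖ'`, the twisted witness
`ρ` through `(ι, e)` and its absolute irreducibility on quadratic `Γ_L`; `primaryGen_unique` gives `ϖ = ϖ'` off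
`S ∪ S₀`, so the given tower is a polarized avatar tower for the trace function of `ρ` off `S ∪ S₀`; H makes `ρ`
automorphic over `K`; the landed untwist `stub_irregularDescentUntwist` returns `ΣSat(π_K, 𝔭) = e(a_𝔭 f)` a.e. -/
theorem irregularClassicalityPolarized_of_heart
    (hPic : picardCurve_exists_lambdaAdicRep)
    (hH : ∀ (f : Polynomial ℤ) (hcpt : isCompact_glFiniteIntegralLevel 3 (CyclotomicField 3 ℚ)),
          f.natDegree = 4 → (f.map (Int.castRingHom ℚ)).Separable →
          12 ∣ Nat.card (f.map (Int.castRingHom ℚ)).Gal →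
        ∀ (ι : PadicAlgCl 3 ≃+* ℂ) (e : CyclotomicField 3 ℚ →+* ℂ)
          (S₀ : Finset (HeightOneSpectrum (𝓞 (CyclotomicField 3 ℚ))))
          (ϖ : HeightOneSpectrum (𝓞 (CyclotomicField 3 ℚ)) → 𝓞 (CyclotomicField 3 ℚ))
          (ρ : FramedGaloisRep (CyclotomicField 3 ℚ) (PadicAlgCl 3) 3),
          (∀ v : HeightOneSpectrum (𝓞 (CyclotomicField 3 ℚ)),
            ((3 : ℕ) : 𝓞 (CyclotomicField 3 ℚ)) ∈ v.asIdeal → v ∈ S₀) →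
          (∀ 𝔭 ∉ S₀,
            (𝔭.asIdeal = Ideal.span {ϖ 𝔭} ∧
              ϖ 𝔭 - 1 ∈ Ideal.span {(3 : 𝓞 (CyclotomicField 3 ℚ))}) ∧
            ρ.IsUnramifiedAt 𝔭 ∧
            ∀ 𝔓 ∈ 𝔭.primesAbove, ∀ τ : Field.absoluteGaloisGroup (CyclotomicField 3 ℚ),
              IsArithFrobAt (𝓞 (CyclotomicField 3 ℚ)) τ 𝔓 →
                FramedRep.trace ρ τ⁻¹ = ι.symm (e (↑(picardTrace f 𝔭 * ϖ 𝔭)))) →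
          (∀ (L : Type) [Field L] [NumberField L] [Algebra (CyclotomicField 3 ℚ) L],
            Module.finrank (CyclotomicField 3 ℚ) L = 2 →
              FramedRep.IsAbsolutelyIrreducible (ρ.restrictField L)) →
        ∀ (c₀ : CyclotomicField 3 ℚ ≃ₐ[ℚ] CyclotomicField 3 ℚ)
          (S_K : Finset (HeightOneSpectrum (𝓞 (CyclotomicField 3 ℚ)))), c₀ ≠ 1 → S₀ ⊆ S_K →
          (∀ k : ℕ, ∃ (P : CuspidalAutomorphicRepData 3 (CyclotomicField 3 ℚ) hcpt)
            (r : FramedGaloisRep (CyclotomicField 3 ℚ) (PadicAlgCl 3) 3),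
            P.1.IsRegularAlgebraic ∧ P.1.IsConjSelfDualAE c₀ ∧
            ∀ 𝔭 ∉ S_K, P.1.IsUnramifiedAt 𝔭 ∧ IsGaloisCompatibleAt P.1 ι r 𝔭 ∧
              ∃ (α : Multiset ℂ) (t : integralClosure ℤ ℂ), P.1.HasSatakeParamAt 𝔭 α ∧
                (t : ℂ) = (𝔭.residueCard : ℂ) * α.sum - e (↑(picardTrace f 𝔭 * ϖ 𝔭)) ∧
                ‖ι.symm (t : ℂ)‖ ≤ ((3 : ℝ)⁻¹) ^ k) →
        ∃ (π' : CuspidalAutomorphicRepData 3 (CyclotomicField 3 ℚ) hcpt)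
          (S' : Finset (HeightOneSpectrum (𝓞 (CyclotomicField 3 ℚ)))),
          π'.1.IsLAlgebraic ∧
          ∀ 𝔭 ∉ S', ∃ α : Multiset ℂ, π'.1.HasSatakeParamAt 𝔭 α ∧
            ρ.IsUnramifiedAt 𝔭 ∧ ρ.HasFrobCharpolyAt 𝔭 (arithFrobPolyOfSatake ι 𝔭.residueCard 1 α)) :
    ∀ (f : Polynomial ℤ) (hcpt : Literature.NumberTheory.Automorphic.isCompact_glFiniteIntegralLevel 3 (CyclotomicField 3 ℚ)), f.natDegree = 4 → (f.map (Int.castRingHom ℚ)).Separable → 12 ∣ Nat.card (f.map (Int.castRingHom ℚ)).Gal → (∃ (e : (CyclotomicField 3 ℚ) →+* ℂ) (ι : PadicAlgCl 3 ≃+* ℂ) (S : Finset (IsDedekindDomain.HeightOneSpectrum (NumberField.RingOfIntegers (CyclotomicField 3 ℚ)))) (c₀ : (CyclotomicField 3 ℚ) ≃ₐ[ℚ] (CyclotomicField 3 ℚ)) (ϖ : (IsDedekindDomain.HeightOneSpectrum (NumberField.RingOfIntegers (CyclotomicField 3 ℚ))) → (NumberField.RingOfIntegers (CyclotomicField 3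 ℚ))), c₀ ≠ 1 ∧ (∀ 𝔭 ∉ S, 𝔭.asIdeal = Ideal.span {ϖ 𝔭} ∧ ϖ 𝔭 - 1 ∈ Ideal.span {(3 : (NumberField.RingOfIntegers (CyclotomicField 3 ℚ)))}) ∧ ∀ k : ℕ, ∃ (P : Literature.NumberTheory.Automorphic.CuspidalAutomorphicRepData 3 (CyclotomicField 3 ℚ) hcpt) (r : Literature.NumberTheory.GaloisRepresentations.FramedGaloisRep (CyclotomicField 3 ℚ) (PadicAlgCl 3) 3), P.1.IsRegularAlgebraic ∧ P.1.IsConjSelfDualAE c₀ ∧ ∀ 𝔭 ∉ S, P.1.IsUnramifiedAt 𝔭 ∧ Literature.NumberTheory.Automorphic.IsGaloisCompatibleAt P.1 ι r 𝔭 ∧ ∃ (α : Multiset ℂ) (t : (integralClosure ℤ ℂ)), P.1.HasSatakeParamAt 𝔭 α ∧ (t : ℂ) = (𝔭.residueCard : ℂ) * α.sum - e (↑(Literature.NumberTheory.GaloisRepresentations.picardTrace f 𝔭 * ϖ 𝔭)) ∧ ‖ι.symm (t : ℂ)‖ ≤ ((3 : ℝ)⁻¹) ^ k) → ∃ (e :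 (CyclotomicField 3 ℚ) →+* ℂ) (π : Literature.NumberTheory.Automorphic.CuspidalAutomorphicRepData 3 (CyclotomicField 3 ℚ) hcpt), π.1.IsLAlgebraic ∧ ∀ᶠ 𝔭 : IsDedekindDomain.HeightOneSpectrum (NumberField.RingOfIntegers (CyclotomicField 3 ℚ)) in Filter.cofinite, ∃ α : Multiset ℂ, π.1.HasSatakeParamAt 𝔭 α ∧ α.sum = e (Literature.NumberTheory.GaloisRepresentations.picardTrace f 𝔭) := by
  intro f hcpt hdeg hsep hgal hyp
  classical
  obtain ⟨e, ι, S, c₀, ϖ, hc₀, hϖ, htower⟩ := hyp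
  -- Stub 2 (landed, conditional on the Picard named fact): S₀, primary generators ϖ', ρ = ρ_C ⊗ ψ
  obtain ⟨S₀, ϖ', ρ, hS₀, hirr, hρ⟩ := stub_twistedPicardGaloisInput hPic f hdeg hsep hgal ι e
  -- primary generators agree off `S ∪ S₀`
  have hϖeq : ∀ 𝔭, 𝔭 ∉ S ∪ S₀ → ϖ 𝔭 = ϖ' 𝔭 := by
    intro 𝔭 h𝔭
    simp only [Finset.mem_union, not_or] at h𝔭
    have h𝔭3 : (3 : 𝓞 (CyclotomicField 3 ℚ)) ∉ 𝔭.asIdeal := fun h =>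
      h𝔭.2 (hS₀ 𝔭 (by rwa [Nat.cast_ofNat]))
    exact primaryGen_unique h𝔭3 (hϖ 𝔭 h𝔭.1).1 (hρ 𝔭 h𝔭.2).1.1 (hϖ 𝔭 h𝔭.1).2 (hρ 𝔭 h𝔭.2).1.2
  -- the given tower, read off `S ∪ S₀`, is a polarized avatar tower for the trace function of ρ
  have havat : ∀ k : ℕ, ∃ (P : CuspidalAutomorphicRepData 3 (CyclotomicField 3 ℚ) hcpt)
      (r : FramedGaloisRep (CyclotomicField 3 ℚ) (PadicAlgCl 3) 3),
      P.1.IsRegularAlgebraic ∧ P.1.IsConjSelfDualAE c₀ ∧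
      ∀ 𝔭 ∉ S ∪ S₀, P.1.IsUnramifiedAt 𝔭 ∧ IsGaloisCompatibleAt P.1 ι r 𝔭 ∧
        ∃ (α : Multiset ℂ) (t : integralClosure ℤ ℂ), P.1.HasSatakeParamAt 𝔭 α ∧
          (t : ℂ) = (𝔭.residueCard : ℂ) * α.sum - e (↑(picardTrace f 𝔭 * ϖ' 𝔭)) ∧
          ‖ι.symm (t : ℂ)‖ ≤ ((3 : ℝ)⁻¹) ^ k := by
    intro k
    obtain ⟨P, r, hreg, hcsd, hP⟩ := htower k
    refine ⟨P, r, hreg, hcsd, fun 𝔭 h𝔭 => ?_⟩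
    have h𝔭S : 𝔭 ∉ S := fun h => h𝔭 (Finset.mem_union_left _ h)
    obtain ⟨hunr, hcomp, α, t, hα, ht, hnorm⟩ := hP 𝔭 h𝔭S
    refine ⟨hunr, hcomp, α, t, hα, ?_, hnorm⟩
    rw [← hϖeq 𝔭 h𝔭]
    exact ht
  -- the heart: ρ is automorphic over K
  obtain ⟨π', S'', hLalg, hcompat⟩ :=
    hH f hcpt hdeg hsep hgal ι e S₀ ϖ' ρ hS₀ hρ hirr c₀ (S ∪ S₀) hc₀ Finset.subset_union_right havat
  -- Stub 6 (landed, unconditional): untwist, in sum form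
  obtain ⟨πK, hKalg, hev⟩ :=
    stub_irregularDescentUntwist f hcpt hdeg hsep hgal ι e S₀ ϖ' ρ hS₀ hρ π' S'' hLalg hcompat
  exact ⟨e, πK, hKalg, hev⟩

/-! ## 2. The typed crux by name -/

/-- **The typed crux from W and C3** — the glue of the prepared split `LimitTwist → PolarizationDebt →
IrregularClassicalityPolarized → IrregularClassicality` with its first child DISCHARGED: twist the typed tower by the
cubic-reciprocity Grössencharacter (landed `stub_limitTwist`), polarize it (W = `PolarizationDebt`, registered stub
`stub_polarizationDebt` VERBATIM — the wall: unprovable as typed, the identity under the tenure restate), apply C3. -/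
theorem irregularClassicality_of_polarized
    (hW : ∀ (f : Polynomial ℤ) (hcpt : Literature.NumberTheory.Automorphic.isCompact_glFiniteIntegralLevel 3 (CyclotomicField 3 ℚ)), f.natDegree = 4 → (f.map (Int.castRingHom ℚ)).Separable → 12 ∣ Nat.card (f.map (Int.castRingHom ℚ)).Gal → (∃ (e : (CyclotomicField 3 ℚ) →+* ℂ) (𝔐 : Ideal (integralClosure ℤ ℂ)) (S : Finset (IsDedekindDomain.HeightOneSpectrum (NumberField.RingOfIntegers (CyclotomicField 3 ℚ)))) (ϖ : (IsDedekindDomain.HeightOneSpectrum (NumberField.RingOfIntegers (CyclotomicField 3 ℚ))) → (NumberField.RingOfIntegers (CyclotomicField 3 ℚ))), 𝔐.IsMaximal ∧ (3 : (integralClosure ℤ ℂ)) ∈ 𝔐 ∧ (∀ 𝔭 ∉ S, 𝔭.asIdeal = Ideal.span {ϖ 𝔭} ∧ ϖ 𝔭 - 1 ∈ Ideal.span {(3 : (NumberField.RingOfIntegers (CyclotomicField 3 ℚ)))}) ∧ ∀ k : ℕ, ∃ P : Literature.NumberTheory.Automorphic.CuspidalAutomorphicRepData 3 (CyclotomicField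 3 ℚ) hcpt, P.1.IsRegularAlgebraic ∧ ∀ 𝔭 ∉ S, ∃ (α : Multiset ℂ) (t u : (integralClosure ℤ ℂ)), P.1.HasSatakeParamAt 𝔭 α ∧ (t : ℂ) = (𝔭.residueCard : ℂ) * α.sum - e (↑(Literature.NumberTheory.GaloisRepresentations.picardTrace f 𝔭 * ϖ 𝔭)) ∧ u ∉ 𝔐 ∧ u * t ∈ Ideal.span {(3 : (integralClosure ℤ ℂ)) ^ k}) → (∃ (e : (CyclotomicField 3 ℚ) →+* ℂ) (ι : PadicAlgCl 3 ≃+* ℂ) (S : Finset (IsDedekindDomain.HeightOneSpectrum (NumberField.RingOfIntegers (CyclotomicField 3 ℚ)))) (c₀ : (CyclotomicField 3 ℚ) ≃ₐ[ℚ] (CyclotomicField 3 ℚ)) (ϖ : (IsDedekindDomain.HeightOneSpectrum (NumberField.RingOfIntegers (CyclotomicField 3 ℚ))) → (NumberField.RingOfIntegers (CyclotomicField 3 ℚ))), c₀ ≠ 1 ∧ (∀ 𝔭 ∉ S, 𝔭.asIdeal = Ideal.span {ϖ 𝔭} ∧ ϖ 𝔭 - 1 ∈ Ideal.span {(3 :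 (NumberField.RingOfIntegers (CyclotomicField 3 ℚ)))}) ∧ ∀ k : ℕ, ∃ (P : Literature.NumberTheory.Automorphic.CuspidalAutomorphicRepData 3 (CyclotomicField 3 ℚ) hcpt) (r : Literature.NumberTheory.GaloisRepresentations.FramedGaloisRep (CyclotomicField 3 ℚ) (PadicAlgCl 3) 3), P.1.IsRegularAlgebraic ∧ P.1.IsConjSelfDualAE c₀ ∧ ∀ 𝔭 ∉ S, P.1.IsUnramifiedAt 𝔭 ∧ Literature.NumberTheory.Automorphic.IsGaloisCompatibleAt P.1 ι r 𝔭 ∧ ∃ (α : Multiset ℂ) (t : (integralClosure ℤ ℂ)), P.1.HasSatakeParamAt 𝔭 α ∧ (t : ℂ) = (𝔭.residueCard : ℂ) * α.sum - e (↑(Literature.NumberTheory.GaloisRepresentations.picardTrace f 𝔭 * ϖ 𝔭)) ∧ ‖ι.symm (t : ℂ)‖ ≤ ((3 : ℝ)⁻¹) ^ k))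
    (hC3 : ∀ (f : Polynomial ℤ) (hcpt : Literature.NumberTheory.Automorphic.isCompact_glFiniteIntegralLevel 3 (CyclotomicField 3 ℚ)), f.natDegree = 4 → (f.map (Int.castRingHom ℚ)).Separable → 12 ∣ Nat.card (f.map (Int.castRingHom ℚ)).Gal → (∃ (e : (CyclotomicField 3 ℚ) →+* ℂ) (ι : PadicAlgCl 3 ≃+* ℂ) (S : Finset (IsDedekindDomain.HeightOneSpectrum (NumberField.RingOfIntegers (CyclotomicField 3 ℚ)))) (c₀ : (CyclotomicField 3 ℚ) ≃ₐ[ℚ] (CyclotomicField 3 ℚ)) (ϖ : (IsDedekindDomain.HeightOneSpectrum (NumberField.RingOfIntegers (CyclotomicField 3 ℚ))) → (NumberField.RingOfIntegers (CyclotomicField 3 ℚ))), c₀ ≠ 1 ∧ (∀ 𝔭 ∉ S, 𝔭.asIdeal = Ideal.span {ϖ 𝔭} ∧ ϖ 𝔭 - 1 ∈ Ideal.span {(3 : (NumberField.RingOfIntegers (CyclotomicField 3 ℚ)))}) ∧ ∀ k : ℕ, ∃ (P : Literature.NumberTheory.Automorphic.CuspidalAutomorphicRepData 3 (CyclotomicField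 3 ℚ) hcpt) (r : Literature.NumberTheory.GaloisRepresentations.FramedGaloisRep (CyclotomicField 3 ℚ) (PadicAlgCl 3) 3), P.1.IsRegularAlgebraic ∧ P.1.IsConjSelfDualAE c₀ ∧ ∀ 𝔭 ∉ S, P.1.IsUnramifiedAt 𝔭 ∧ Literature.NumberTheory.Automorphic.IsGaloisCompatibleAt P.1 ι r 𝔭 ∧ ∃ (α : Multiset ℂ) (t : (integralClosure ℤ ℂ)), P.1.HasSatakeParamAt 𝔭 α ∧ (t : ℂ) = (𝔭.residueCard : ℂ) * α.sum - e (↑(Literature.NumberTheory.GaloisRepresentations.picardTrace f 𝔭 * ϖ 𝔭)) ∧ ‖ι.symm (t : ℂ)‖ ≤ ((3 : ℝ)⁻¹) ^ k) → ∃ (e : (CyclotomicField 3 ℚ) →+* ℂ) (π : Literature.NumberTheory.Automorphic.CuspidalAutomorphicRepData 3 (CyclotomicField 3 ℚ) hcpt), π.1.IsLAlgebraic ∧ ∀ᶠ 𝔭 : IsDedekindDomain.HeightOneSpectrum (NumberField.RingOfIntegers (CyclotomicField 3 ℚ)) in Filter.cofinite, ∃ α : Multiset ℂ, π.1.HasSatakeParamAt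 𝔭 α ∧ α.sum = e (Literature.NumberTheory.GaloisRepresentations.picardTrace f 𝔭)) :
    IrregularClassicality :=
  fun f hcpt hdeg hsep hgal hlim =>
    hC3 f hcpt hdeg hsep hgal (hW f hcpt hdeg hsep hgal (stub_limitTwist f hcpt hdeg hsep hgal hlim))

/-- **The typed crux from the Picard fact, the wall W and the heart H** — the registered skeleton's composition
`IrregularClassicality_of` (line `slope-free-polarized-limit`, r3) with its three `sorry`s (Stubs P, W, H, VERBATIM) as
hypotheses: `irregularClassicality_of_polarized` after `irregularClassicalityPolarized_of_heart`. -/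
theorem irregularClassicality_of_wall_of_heart : picardCurve_exists_lambdaAdicRep → (∀ (f : ℤ[X]) (hcpt : isCompact_glFiniteIntegralLevel 3 (CyclotomicField 3 ℚ)), f.natDegree = 4 → (f.map (Int.castRingHom ℚ)).Separable → 12 ∣ Nat.card (f.map (Int.castRingHom ℚ)).Gal → (∃ (e : CyclotomicField 3 ℚ →+* ℂ) (𝔐 : Ideal (integralClosure ℤ ℂ)) (S : Finset (HeightOneSpectrum (𝓞 (CyclotomicField 3 ℚ)))) (ϖ : HeightOneSpectrum (𝓞 (CyclotomicField 3 ℚ)) → 𝓞 (CyclotomicField 3 ℚ)), 𝔐.IsMaximal ∧ (3 : integralClosure ℤ ℂ) ∈ 𝔐 ∧ (∀ 𝔭 ∉ S, 𝔭.asIdeal = Ideal.span {ϖ 𝔭} ∧ ϖ 𝔭 - 1 ∈ Ideal.span {(3 : 𝓞 (CyclotomicField 3 ℚ))}) ∧ ∀ k : ℕ, ∃ P : CuspidalAutomorphicRepData 3 (CyclotomicField 3 ℚ) hcpt, P.1.IsRegularAlgebraic ∧ ∀ 𝔭 ∉ S, ∃ (α : Multiset ℂ) (t u : integralClosure ℤ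 ℂ), P.1.HasSatakeParamAt 𝔭 α ∧ (t : ℂ) = (𝔭.residueCard : ℂ) * α.sum - e (↑(picardTrace f 𝔭 * ϖ 𝔭)) ∧ u ∉ 𝔐 ∧ u * t ∈ Ideal.span {(3 : integralClosure ℤ ℂ) ^ k}) → (∃ (e : CyclotomicField 3 ℚ →+* ℂ) (ι : PadicAlgCl 3 ≃+* ℂ) (S : Finset (HeightOneSpectrum (𝓞 (CyclotomicField 3 ℚ)))) (c₀ : CyclotomicField 3 ℚ ≃ₐ[ℚ] CyclotomicField 3 ℚ) (ϖ : HeightOneSpectrum (𝓞 (CyclotomicField 3 ℚ)) → 𝓞 (CyclotomicField 3 ℚ)), c₀ ≠ 1 ∧ (∀ 𝔭 ∉ S, 𝔭.asIdeal = Ideal.span {ϖ 𝔭} ∧ ϖ 𝔭 - 1 ∈ Ideal.span {(3 : 𝓞 (CyclotomicField 3 ℚ))}) ∧ ∀ k : ℕ, ∃ (P : CuspidalAutomorphicRepData 3 (CyclotomicField 3 ℚ) hcpt) (r : FramedGaloisRep (CyclotomicField 3 ℚ) (PadicAlgCl 3) 3), P.1.IsRegularAlgebraic ∧ P.1.IsConjSelfDualAE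 c₀ ∧ ∀ 𝔭 ∉ S, P.1.IsUnramifiedAt 𝔭 ∧ IsGaloisCompatibleAt P.1 ι r 𝔭 ∧ ∃ (α : Multiset ℂ) (t : integralClosure ℤ ℂ), P.1.HasSatakeParamAt 𝔭 α ∧ (t : ℂ) = (𝔭.residueCard : ℂ) * α.sum - e (↑(picardTrace f 𝔭 * ϖ 𝔭)) ∧ ‖ι.symm (t : ℂ)‖ ≤ ((3 : ℝ)⁻¹) ^ k)) → (∀ (f : ℤ[X]) (hcpt : isCompact_glFiniteIntegralLevel 3 (CyclotomicField 3 ℚ)), f.natDegree = 4 → (f.map (Int.castRingHom ℚ)).Separable → 12 ∣ Nat.card (f.map (Int.castRingHom ℚ)).Gal → ∀ (ι : PadicAlgCl 3 ≃+* ℂ) (e : CyclotomicField 3 ℚ →+* ℂ) (S₀ : Finset (HeightOneSpectrum (𝓞 (CyclotomicField 3 ℚ)))) (ϖ : HeightOneSpectrum (𝓞 (CyclotomicField 3 ℚ)) → 𝓞 (CyclotomicField 3 ℚ)) (ρ : FramedGaloisRep (CyclotomicField 3 ℚ) (PadicAlgCl 3) 3), (∀ v : HeightOneSpectrum (𝓞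 (CyclotomicField 3 ℚ)), ((3 : ℕ) : 𝓞 (CyclotomicField 3 ℚ)) ∈ v.asIdeal → v ∈ S₀) → (∀ 𝔭 ∉ S₀, (𝔭.asIdeal = Ideal.span {ϖ 𝔭} ∧ ϖ 𝔭 - 1 ∈ Ideal.span {(3 : 𝓞 (CyclotomicField 3 ℚ))}) ∧ ρ.IsUnramifiedAt 𝔭 ∧ ∀ 𝔓 ∈ 𝔭.primesAbove, ∀ τ : Field.absoluteGaloisGroup (CyclotomicField 3 ℚ), IsArithFrobAt (𝓞 (CyclotomicField 3 ℚ)) τ 𝔓 → FramedRep.trace ρ τ⁻¹ = ι.symm (e (↑(picardTrace f 𝔭 * ϖ 𝔭)))) → (∀ (L : Type) [Field L] [NumberField L] [Algebra (CyclotomicField 3 ℚ) L], Module.finrank (CyclotomicField 3 ℚ) L = 2 → FramedRep.IsAbsolutelyIrreducible (ρ.restrictField L)) → ∀ (c₀ : CyclotomicField 3 ℚ ≃ₐ[ℚ] CyclotomicField 3 ℚ) (S_K : Finset (HeightOneSpectrum (𝓞 (CyclotomicField 3 ℚ)))), c₀ ≠ 1 → S₀ ⊆ S_K → (∀ k : ℕ,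 ∃ (P : CuspidalAutomorphicRepData 3 (CyclotomicField 3 ℚ) hcpt) (r : FramedGaloisRep (CyclotomicField 3 ℚ) (PadicAlgCl 3) 3), P.1.IsRegularAlgebraic ∧ P.1.IsConjSelfDualAE c₀ ∧ ∀ 𝔭 ∉ S_K, P.1.IsUnramifiedAt 𝔭 ∧ IsGaloisCompatibleAt P.1 ι r 𝔭 ∧ ∃ (α : Multiset ℂ) (t : integralClosure ℤ ℂ), P.1.HasSatakeParamAt 𝔭 α ∧ (t : ℂ) = (𝔭.residueCard : ℂ) * α.sum - e (↑(picardTrace f 𝔭 * ϖ 𝔭)) ∧ ‖ι.symm (t : ℂ)‖ ≤ ((3 : ℝ)⁻¹) ^ k) → ∃ (π' : CuspidalAutomorphicRepData 3 (CyclotomicField 3 ℚ) hcpt) (S' : Finset (HeightOneSpectrum (𝓞 (CyclotomicField 3 ℚ)))), π'.1.IsLAlgebraic ∧ ∀ 𝔭 ∉ S', ∃ α : Multiset ℂ, π'.1.HasSatakeParamAt 𝔭 α ∧ ρ.IsUnramifiedAt 𝔭 ∧ ρ.HasFrobCharpolyAt 𝔭 (arithFrobPolyOfSatake ι 𝔭.residueCard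 1 α)) → IrregularClassicality :=
  fun hPic hW hH => irregularClassicality_of_polarized hW (irregularClassicalityPolarized_of_heart hPic hH)

/-! ## 3. Read-backs: C3 sits between the target and the ordinary restate -/

/-- C3 is a weakening of the target `PicardAutomorphy` (no refutation room: its conclusion IS the target's at `f`). -/
theorem irregularClassicalityPolarized_of_picardAutomorphy (hX : PicardAutomorphy) :
    ∀ (f : Polynomial ℤ) (hcpt : Literature.NumberTheory.Automorphic.isCompact_glFiniteIntegralLevel 3 (CyclotomicField 3 ℚ)), f.natDegree = 4 → (f.map (Int.castRingHom ℚ)).Separable → 12 ∣ Nat.card (f.map (Int.castRingHom ℚ)).Gal → (∃ (e : (CyclotomicField 3 ℚ) →+* ℂ) (ι : PadicAlgCl 3 ≃+* ℂ) (S : Finset (IsDedekindDomain.HeightOneSpectrum (NumberField.RingOfIntegers (CyclotomicField 3 ℚ)))) (c₀ : (CyclotomicField 3 ℚ) ≃ₐ[ℚ] (CyclotomicField 3 ℚ)) (ϖ : (IsDedekindDomain.HeightOneSpectrum (NumberField.RingOfIntegers (CyclotomicField 3 ℚ))) → (NumberField.RingOfIntegers (CyclotomicField 3 ℚ))), c₀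 ≠ 1 ∧ (∀ 𝔭 ∉ S, 𝔭.asIdeal = Ideal.span {ϖ 𝔭} ∧ ϖ 𝔭 - 1 ∈ Ideal.span {(3 : (NumberField.RingOfIntegers (CyclotomicField 3 ℚ)))}) ∧ ∀ k : ℕ, ∃ (P : Literature.NumberTheory.Automorphic.CuspidalAutomorphicRepData 3 (CyclotomicField 3 ℚ) hcpt) (r : Literature.NumberTheory.GaloisRepresentations.FramedGaloisRep (CyclotomicField 3 ℚ) (PadicAlgCl 3) 3), P.1.IsRegularAlgebraic ∧ P.1.IsConjSelfDualAE c₀ ∧ ∀ 𝔭 ∉ S, P.1.IsUnramifiedAt 𝔭 ∧ Literature.NumberTheory.Automorphic.IsGaloisCompatibleAt P.1 ι r 𝔭 ∧ ∃ (α : Multiset ℂ) (t : (integralClosure ℤ ℂ)), P.1.HasSatakeParamAt 𝔭 α ∧ (t : ℂ) = (𝔭.residueCard : ℂ) * α.sum - e (↑(Literature.NumberTheory.GaloisRepresentations.picardTrace f 𝔭 * ϖ 𝔭)) ∧ ‖ι.symm (t : ℂ)‖ ≤ ((3 : ℝ)⁻¹) ^ k) → ∃ (e : (CyclotomicField 3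 ℚ) →+* ℂ) (π : Literature.NumberTheory.Automorphic.CuspidalAutomorphicRepData 3 (CyclotomicField 3 ℚ) hcpt), π.1.IsLAlgebraic ∧ ∀ᶠ 𝔭 : IsDedekindDomain.HeightOneSpectrum (NumberField.RingOfIntegers (CyclotomicField 3 ℚ)) in Filter.cofinite, ∃ α : Multiset ℂ, π.1.HasSatakeParamAt 𝔭 α ∧ α.sum = e (Literature.NumberTheory.GaloisRepresentations.picardTrace f 𝔭) :=
  fun f hcpt hdeg hsep hgal _ => hX f hcpt hdeg hsep hgal

/-- C3 implies lead c1's ordinary restate `IrregularClassicalityOrd` (Defs §4): drop the ordinarity conjunct of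
`OrdPolarizedTower`.  So the slope-free restate concedes nothing the ordinary one does not, and needs no third branch. -/
theorem irregularClassicalityOrd_of_polarized
    (h : ∀ (f : Polynomial ℤ) (hcpt : Literature.NumberTheory.Automorphic.isCompact_glFiniteIntegralLevel 3 (CyclotomicField 3 ℚ)), f.natDegree = 4 → (f.map (Int.castRingHom ℚ)).Separable → 12 ∣ Nat.card (f.map (Int.castRingHom ℚ)).Gal → (∃ (e : (CyclotomicField 3 ℚ) →+* ℂ) (ι : PadicAlgCl 3 ≃+* ℂ) (S : Finset (IsDedekindDomain.HeightOneSpectrum (NumberField.RingOfIntegers (CyclotomicField 3 ℚ)))) (c₀ : (CyclotomicField 3 ℚ) ≃ₐ[ℚ] (CyclotomicField 3 ℚ)) (ϖ : (IsDedekindDomain.HeightOneSpectrum (NumberField.RingOfIntegers (CyclotomicField 3 ℚ))) → (NumberField.RingOfIntegers (CyclotomicField 3 ℚ))), c₀ ≠ 1 ∧ (∀ 𝔭 ∉ S, 𝔭.asIdeal = Ideal.span {ϖ 𝔭} ∧ ϖ 𝔭 - 1 ∈ Ideal.span {(3 : (NumberField.RingOfIntegers (CyclotomicField 3 ℚ)))})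 ∧ ∀ k : ℕ, ∃ (P : Literature.NumberTheory.Automorphic.CuspidalAutomorphicRepData 3 (CyclotomicField 3 ℚ) hcpt) (r : Literature.NumberTheory.GaloisRepresentations.FramedGaloisRep (CyclotomicField 3 ℚ) (PadicAlgCl 3) 3), P.1.IsRegularAlgebraic ∧ P.1.IsConjSelfDualAE c₀ ∧ ∀ 𝔭 ∉ S, P.1.IsUnramifiedAt 𝔭 ∧ Literature.NumberTheory.Automorphic.IsGaloisCompatibleAt P.1 ι r 𝔭 ∧ ∃ (α : Multiset ℂ) (t : (integralClosure ℤ ℂ)), P.1.HasSatakeParamAt 𝔭 α ∧ (t : ℂ) = (𝔭.residueCard : ℂ) * α.sum - e (↑(Literature.NumberTheory.GaloisRepresentations.picardTrace f 𝔭 * ϖ 𝔭)) ∧ ‖ι.symm (t : ℂ)‖ ≤ ((3 : ℝ)⁻¹) ^ k) → ∃ (e : (CyclotomicField 3 ℚ) →+* ℂ) (π : Literature.NumberTheory.Automorphic.CuspidalAutomorphicRepData 3 (CyclotomicField 3 ℚ) hcpt), π.1.IsLAlgebraic ∧ ∀ᶠ 𝔭 : IsDedekindDomain.HeightOneSpectrum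 (NumberField.RingOfIntegers (CyclotomicField 3 ℚ)) in Filter.cofinite, ∃ α : Multiset ℂ, π.1.HasSatakeParamAt 𝔭 α ∧ α.sum = e (Literature.NumberTheory.GaloisRepresentations.picardTrace f 𝔭)) :
    IrregularClassicalityOrd := by
  intro art f hcpt hdeg hsep hgal hyp
  obtain ⟨e, ι, S, c₀, ϖ, hc₀, hϖ, htower⟩ := hyp
  refine h f hcpt hdeg hsep hgal ⟨e, ι, S, c₀, ϖ, hc₀, hϖ, fun k => ?_⟩
  obtain ⟨P, r, hreg, hcsd, hP, _hord⟩ := htower k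
  exact ⟨P, r, hreg, hcsd, hP⟩

/-! ## 4. The slope-free re-routed deciding theorem -/

/-- **The slope-free re-routed items imply the TARGET.**  With 13757 restated as `MuOrdinaryFamilyRTPolarized`
(hypothesis VERBATIM the residual hypothesis `ResidualHyp f hcpt` = the conclusion of `ResidualAutomorphyOdd/Even`;
conclusion VERBATIM the hypothesis of C3: an exactly `c₀`-polarized twisted `3`-adic tower with avatars) and 13758
restated as C3, the two residual branches of the CURRENT route give the target `PicardAutomorphy` — no case split, no
third branch. -/
theorem picardAutomorphy_of_polarized (hOdd : ResidualAutomorphyOdd) (hEven : ResidualAutomorphyEven)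
    (hRT : ∀ (f : Polynomial ℤ) (hcpt : Literature.NumberTheory.Automorphic.isCompact_glFiniteIntegralLevel 3 (CyclotomicField 3 ℚ)), f.natDegree = 4 → (f.map (Int.castRingHom ℚ)).Separable → 12 ∣ Nat.card (f.map (Int.castRingHom ℚ)).Gal → ResidualHyp f hcpt → (∃ (e : (CyclotomicField 3 ℚ) →+* ℂ) (ι : PadicAlgCl 3 ≃+* ℂ) (S : Finset (IsDedekindDomain.HeightOneSpectrum (NumberField.RingOfIntegers (CyclotomicField 3 ℚ)))) (c₀ : (CyclotomicField 3 ℚ) ≃ₐ[ℚ] (CyclotomicField 3 ℚ)) (ϖ : (IsDedekindDomain.HeightOneSpectrum (NumberField.RingOfIntegers (CyclotomicField 3 ℚ))) → (NumberField.RingOfIntegers (CyclotomicField 3 ℚ))), c₀ ≠ 1 ∧ (∀ 𝔭 ∉ S, 𝔭.asIdeal = Ideal.span {ϖ 𝔭} ∧ ϖ 𝔭 - 1 ∈ Ideal.span {(3 : (NumberField.RingOfIntegers (CyclotomicField 3 ℚ)))}) ∧ ∀ k : ℕ, ∃ (P : Literature.NumberTheory.Automorphic.CuspidalAutomorphicRepData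 3 (CyclotomicField 3 ℚ) hcpt) (r : Literature.NumberTheory.GaloisRepresentations.FramedGaloisRep (CyclotomicField 3 ℚ) (PadicAlgCl 3) 3), P.1.IsRegularAlgebraic ∧ P.1.IsConjSelfDualAE c₀ ∧ ∀ 𝔭 ∉ S, P.1.IsUnramifiedAt 𝔭 ∧ Literature.NumberTheory.Automorphic.IsGaloisCompatibleAt P.1 ι r 𝔭 ∧ ∃ (α : Multiset ℂ) (t : (integralClosure ℤ ℂ)), P.1.HasSatakeParamAt 𝔭 α ∧ (t : ℂ) = (𝔭.residueCard : ℂ) * α.sum - e (↑(Literature.NumberTheory.GaloisRepresentations.picardTrace f 𝔭 * ϖ 𝔭)) ∧ ‖ι.symm (t : ℂ)‖ ≤ ((3 : ℝ)⁻¹) ^ k))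
    (hCl : ∀ (f : Polynomial ℤ) (hcpt : Literature.NumberTheory.Automorphic.isCompact_glFiniteIntegralLevel 3 (CyclotomicField 3 ℚ)), f.natDegree = 4 → (f.map (Int.castRingHom ℚ)).Separable → 12 ∣ Nat.card (f.map (Int.castRingHom ℚ)).Gal → (∃ (e : (CyclotomicField 3 ℚ) →+* ℂ) (ι : PadicAlgCl 3 ≃+* ℂ) (S : Finset (IsDedekindDomain.HeightOneSpectrum (NumberField.RingOfIntegers (CyclotomicField 3 ℚ)))) (c₀ : (CyclotomicField 3 ℚ) ≃ₐ[ℚ] (CyclotomicField 3 ℚ)) (ϖ : (IsDedekindDomain.HeightOneSpectrum (NumberField.RingOfIntegers (CyclotomicField 3 ℚ))) → (NumberField.RingOfIntegers (CyclotomicField 3 ℚ))), c₀ ≠ 1 ∧ (∀ 𝔭 ∉ S, 𝔭.asIdeal = Ideal.span {ϖ 𝔭} ∧ ϖ 𝔭 - 1 ∈ Ideal.span {(3 : (NumberField.RingOfIntegers (CyclotomicField 3 ℚ)))}) ∧ ∀ k : ℕ, ∃ (P : Literature.NumberTheory.Automorphic.CuspidalAutomorphicRepData 3 (CyclotomicField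 3 ℚ) hcpt) (r : Literature.NumberTheory.GaloisRepresentations.FramedGaloisRep (CyclotomicField 3 ℚ) (PadicAlgCl 3) 3), P.1.IsRegularAlgebraic ∧ P.1.IsConjSelfDualAE c₀ ∧ ∀ 𝔭 ∉ S, P.1.IsUnramifiedAt 𝔭 ∧ Literature.NumberTheory.Automorphic.IsGaloisCompatibleAt P.1 ι r 𝔭 ∧ ∃ (α : Multiset ℂ) (t : (integralClosure ℤ ℂ)), P.1.HasSatakeParamAt 𝔭 α ∧ (t : ℂ) = (𝔭.residueCard : ℂ) * α.sum - e (↑(Literature.NumberTheory.GaloisRepresentations.picardTrace f 𝔭 * ϖ 𝔭)) ∧ ‖ι.symm (t : ℂ)‖ ≤ ((3 : ℝ)⁻¹) ^ k) → ∃ (e : (CyclotomicField 3 ℚ) →+* ℂ) (π : Literature.NumberTheory.Automorphic.CuspidalAutomorphicRepData 3 (CyclotomicField 3 ℚ) hcpt), π.1.IsLAlgebraic ∧ ∀ᶠ 𝔭 : IsDedekindDomain.HeightOneSpectrum (NumberField.RingOfIntegers (CyclotomicField 3 ℚ)) in Filter.cofinite, ∃ α : Multiset ℂ, π.1.HasSatakeParamAt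 𝔭 α ∧ α.sum = e (Literature.NumberTheory.GaloisRepresentations.picardTrace f 𝔭)) :
    PicardAutomorphy :=
  fun f hcpt hdeg hsep hgal =>
    hCl f hcpt hdeg hsep hgal (hRT f hcpt hdeg hsep hgal (residualHyp_of_branches hOdd hEven f hcpt hdeg hsep hgal))

/-- **`closes_polarized` — the slope-free re-routed deciding theorem**, in the shape of the route's `closes`:
`ResidualAutomorphyOdd → ResidualAutomorphyEven → MuOrdinaryFamilyRTPolarized → IrregularClassicalityPolarized →
SectorComplement → Langlands` (four items and the complement; compare `closes_ord`, which needs the third branch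
`BasicLocusAutomorphy`). -/
theorem closes_polarized (hOdd : ResidualAutomorphyOdd) (hEven : ResidualAutomorphyEven)
    (hRT : ∀ (f : Polynomial ℤ) (hcpt : Literature.NumberTheory.Automorphic.isCompact_glFiniteIntegralLevel 3 (CyclotomicField 3 ℚ)), f.natDegree = 4 → (f.map (Int.castRingHom ℚ)).Separable → 12 ∣ Nat.card (f.map (Int.castRingHom ℚ)).Gal → ResidualHyp f hcpt → (∃ (e : (CyclotomicField 3 ℚ) →+* ℂ) (ι : PadicAlgCl 3 ≃+* ℂ) (S : Finset (IsDedekindDomain.HeightOneSpectrum (NumberField.RingOfIntegers (CyclotomicField 3 ℚ)))) (c₀ : (CyclotomicField 3 ℚ) ≃ₐ[ℚ] (CyclotomicField 3 ℚ)) (ϖ : (IsDedekindDomain.HeightOneSpectrum (NumberField.RingOfIntegers (CyclotomicField 3 ℚ))) → (NumberField.RingOfIntegers (CyclotomicField 3 ℚ))), c₀ ≠ 1 ∧ (∀ 𝔭 ∉ S, 𝔭.asIdeal = Ideal.span {ϖ 𝔭} ∧ ϖ 𝔭 - 1 ∈ Ideal.span {(3 : (NumberField.RingOfIntegers (CyclotomicField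 3 ℚ)))}) ∧ ∀ k : ℕ, ∃ (P : Literature.NumberTheory.Automorphic.CuspidalAutomorphicRepData 3 (CyclotomicField 3 ℚ) hcpt) (r : Literature.NumberTheory.GaloisRepresentations.FramedGaloisRep (CyclotomicField 3 ℚ) (PadicAlgCl 3) 3), P.1.IsRegularAlgebraic ∧ P.1.IsConjSelfDualAE c₀ ∧ ∀ 𝔭 ∉ S, P.1.IsUnramifiedAt 𝔭 ∧ Literature.NumberTheory.Automorphic.IsGaloisCompatibleAt P.1 ι r 𝔭 ∧ ∃ (α : Multiset ℂ) (t : (integralClosure ℤ ℂ)), P.1.HasSatakeParamAt 𝔭 α ∧ (t : ℂ) = (𝔭.residueCard : ℂ) * α.sum - e (↑(Literature.NumberTheory.GaloisRepresentations.picardTrace f 𝔭 * ϖ 𝔭)) ∧ ‖ι.symm (t : ℂ)‖ ≤ ((3 : ℝ)⁻¹) ^ k))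
    (hCl : ∀ (f : Polynomial ℤ) (hcpt : Literature.NumberTheory.Automorphic.isCompact_glFiniteIntegralLevel 3 (CyclotomicField 3 ℚ)), f.natDegree = 4 → (f.map (Int.castRingHom ℚ)).Separable → 12 ∣ Nat.card (f.map (Int.castRingHom ℚ)).Gal → (∃ (e : (CyclotomicField 3 ℚ) →+* ℂ) (ι : PadicAlgCl 3 ≃+* ℂ) (S : Finset (IsDedekindDomain.HeightOneSpectrum (NumberField.RingOfIntegers (CyclotomicField 3 ℚ)))) (c₀ : (CyclotomicField 3 ℚ) ≃ₐ[ℚ] (CyclotomicField 3 ℚ)) (ϖ : (IsDedekindDomain.HeightOneSpectrum (NumberField.RingOfIntegers (CyclotomicField 3 ℚ))) → (NumberField.RingOfIntegers (CyclotomicField 3 ℚ))), c₀ ≠ 1 ∧ (∀ 𝔭 ∉ S, 𝔭.asIdeal = Ideal.span {ϖ 𝔭} ∧ ϖ 𝔭 - 1 ∈ Ideal.span {(3 : (NumberField.RingOfIntegers (CyclotomicField 3 ℚ)))}) ∧ ∀ k : ℕ, ∃ (P : Literature.NumberTheory.Automorphic.CuspidalAutomorphicRepData 3 (CyclotomicField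 3 ℚ) hcpt) (r : Literature.NumberTheory.GaloisRepresentations.FramedGaloisRep (CyclotomicField 3 ℚ) (PadicAlgCl 3) 3), P.1.IsRegularAlgebraic ∧ P.1.IsConjSelfDualAE c₀ ∧ ∀ 𝔭 ∉ S, P.1.IsUnramifiedAt 𝔭 ∧ Literature.NumberTheory.Automorphic.IsGaloisCompatibleAt P.1 ι r 𝔭 ∧ ∃ (α : Multiset ℂ) (t : (integralClosure ℤ ℂ)), P.1.HasSatakeParamAt 𝔭 α ∧ (t : ℂ) = (𝔭.residueCard : ℂ) * α.sum - e (↑(Literature.NumberTheory.GaloisRepresentations.picardTrace f 𝔭 * ϖ 𝔭)) ∧ ‖ι.symm (t : ℂ)‖ ≤ ((3 : ℝ)⁻¹) ^ k) → ∃ (e : (CyclotomicField 3 ℚ) →+* ℂ) (π : Literature.NumberTheory.Automorphic.CuspidalAutomorphicRepData 3 (CyclotomicField 3 ℚ) hcpt), π.1.IsLAlgebraic ∧ ∀ᶠ 𝔭 : IsDedekindDomain.HeightOneSpectrum (NumberField.RingOfIntegers (CyclotomicField 3 ℚ)) in Filter.cofinite, ∃ α : Multiset ℂ, π.1.HasSatakeParamAt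 𝔭 α ∧ α.sum = e (Literature.NumberTheory.GaloisRepresentations.picardTrace f 𝔭))
    (hC : SectorComplement) : _root_.Langlands :=
  hC (picardAutomorphy_of_polarized hOdd hEven hRT hCl)

end

end Summit.Langlands.Langlands.Theorems.IrregularClassicality.SlopeFreePolarizedLimit
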